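import Summits.QuantumFields.QCD.Theorems.QuarksAsStableActionStableActionBridgeAPTraceForm
import Summits.QuantumFields.QCD.Theorems.QuarksAsStableActionStableActionBridgeDiracMatrixTransferForm

/-!
# The `N_f`-flavour thermal trace formula for the time-antiperiodic Wilson–Dirac determinant
(crux `QuarksAsStableAction.StableActionBridge`, item stmt-QuantumFields-9737, line `Sketch`;
registered stub `det_diracMatrixAP_eq_trace_fermionSliceOp`, the `N_f`-flavour version of the
antiperiodic capstone B `wilsonDiracAP_det_eq_trace_fermionSliceOp`)

For an `SU(3)` gauge field `U` on the four-torus `(ℤ/L)⁴` (`L ≥ 1`) and `N_f` flavours of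
`r = 1` Wilson quarks of bare masses `m_f > −1` in the fundamental representation, with the
time-ANTIPERIODIC boundary condition of `QCDTimeReflection.wilsonDiracAP`, the determinant of the
flavour-diagonal antiperiodic Wilson–Dirac matrix `D^{AP}(U) = diracMatrixAP U mq` is the honest
Fock-space TRACE, over the `N_f`-flavour slice Fock space, of the time-ordered product of Smit's
fermionic transfer operators `T̂_F(U_t) = (det A(U_t))² Γ(M_F(U_t))` (`fermionSliceOp`,
Smit (6.91)) interleaved with the Gauss-law gauge rotations `Γ(G_t)` (`fockGaugeAct`,
Smit §4.6 (4.125)–(4.127)) by the temporal links leaving slice `t`: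

  `det D^{AP}(U) = Tr ∏_{t=0}^{L−1} T̂_F(U_t) Γ(G_t)`.

This is Montvay–Münster (4.34) for `N_f` flavours (§5.1: the quark matrix is flavour diagonal):
the Grassmann integral with ANTIPERIODIC time computes the thermal trace `Tr T̂^L`.

Assembly: `det D^{AP}(U) = ∏_f det D_W^{AP}[U; m_f]` (`det_diracMatrixAP_eq_prod_flavour`, the
flavour blocks, exactly as `det_diracMatrix`); flavour by flavour the antiperiodic capstone A
(`wilsonDiracAP_det_eq_smit_transfer_form`) gives
`det D_W^{AP}[U; m_f] = (∏_t det A(U_t)[m_f]²) · det (1 + ∏_t M_F(U_t)[m_f] G_t)`; the product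
over flavours of `det A(U_t)[m_f]` is `det A(U_t)[mq]`
(`DiracMatrixTransferForm.det_sliceMassHop_eq_prod_flavour`) and that of the one-flavour
`det (1 + ∏_t M_F G_t)` is the `N_f`-flavour one (`M_F(U_t)` and `G_t` are flavour-block-diagonal,
`FlavourBlocks.*`); finally the `ZMod L`-product is the ordered product over `List.range L`
(`SupertraceTransferForm.prod_univ_zmod_eq`) and the index-generic abstract trace form
`APTraceForm.trace_form` (`det (1 + Y) = Tr Γ(Y)`, `Γ ∘ reindex` multiplicative and unital along
the enumeration `sliceQuarkEquiv` of the `N_f`-flavour slice quark modes) applies verbatim.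
Pure theorem file (no definitions).

References: I. Montvay, G. Münster, *Quantum Fields on a Lattice* (CUP 1994), §4.1.3 (4.34) and
§5.1 [MontvayMunster1994, §4.1.3 (4.34), §5.1]; M. Lüscher, Commun. Math. Phys. 54 (1977) 283
[Luscher1977, pp. 283–292]; J. Smit, *Introduction to Quantum Fields on a Lattice*, §6.5
(6.87)–(6.91) [Smit2023, §6.5 (6.87)–(6.91)].
-/

noncomputable section

namespace Summit.QuantumFields.QCD.Cruxes.StableActionBridge.Sketch

open MeasureTheory Matrix Literature.MathematicalPhysics.QuantumFieldTheory
  Literature.MathematicalPhysics.QuantumLattice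
open Literature.Probability.LatticeModels (TorusSite)

/-- **`det D^{AP}(U) = ∏_f det D_W^{AP}[U; m_f]`**: the `N_f`-flavour antiperiodic Wilson–Dirac
matrix `diracMatrixAP U mq` is block-diagonal in flavour (its `f`-block is the one-flavour
antiperiodic operator `wilsonDiracAP (fundamentalRep (Fin 3)) U (mq f) 1`), so its determinant is
the product of the one-flavour antiperiodic fermion determinants (the antiperiodic twin of
`det_diracMatrix`, Montvay–Münster §5.1). [cite: MontvayMunster1994, §5.1] -/
theorem det_diracMatrixAP_eq_prod_flavour {Nf L : ℕ} [NeZero L]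
    (U : GaugeConfig 4 L (Matrix.specialUnitaryGroup (Fin 3) ℂ)) (mq : Fin Nf → ℝ) :
    (diracMatrixAP U mq).det =
      ∏ f : Fin Nf,
        (Literature.MathematicalPhysics.QuantumFieldTheory.wilsonDiracAP (fundamentalRep (Fin 3)) U
          (mq f) 1).det := by
  have h : (Matrix.of fun v w : QuarkVar Nf L =>
      if v.1 = w.1 then
        Literature.MathematicalPhysics.QuantumFieldTheory.wilsonDiracAP (fundamentalRep (Fin 3)) U
          (mq v.1) 1 v.2 w.2
      else 0) =
      Matrix.reindex (Equiv.prodComm _ _) (Equiv.prodComm _ _)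
        (Matrix.blockDiagonal fun f =>
          Literature.MathematicalPhysics.QuantumFieldTheory.wilsonDiracAP (fundamentalRep (Fin 3)) U
            (mq f) 1) := by
    ext ⟨f, i⟩ ⟨g, j⟩
    simp only [Matrix.of_apply, Matrix.reindex_apply, Matrix.submatrix_apply,
      Equiv.prodComm_symm, Equiv.prodComm_apply, Prod.swap_prod_mk, Matrix.blockDiagonal_apply']
  unfold diracMatrixAP
  rw [Matrix.det_reindex_self, h, Matrix.det_reindex_self, Matrix.det_blockDiagonal]

namespace DiracMatrixAPTrace

/-- **`det (1 + ∏_i M_F(U_i) G_i)` factorises over flavours** (the `1 +` analogue of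
`det_one_sub_transfer_prod_eq_prod_flavour`): for masses `m_f > −1` the ordered product over the
time slices `i < L` of the `N_f`-flavour one-particle fermionic transfer matrix of the slice
configuration `U_i` times the gauge rotation by the temporal links is flavour-block-diagonal, its
`f`-block the one-flavour product of mass `m_f`, so `det (1 + ·)` is the product of the one-flavour
determinants. [cite: Smit2023, §6.5 (6.91)] -/
theorem det_one_add_transfer_prod_eq_prod_flavour (Nf L : ℕ) [NeZero L]
    (U : GaugeConfig 4 L (Matrix.specialUnitaryGroup (Fin 3) ℂ)) (mq : Fin Nf → ℝ)
    (hm : ∀ f, -1 < mq f) :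
    (1 + ((List.range L).map fun i : ℕ =>
        fermionSliceMatrix
            (fun e : Edge 3 L => U ((Fin.cons (i : ZMod L) e.1 : TorusSite 4 L), e.2.succ)) mq *
          sliceGaugeRot (Nf := Nf)
            (fun y : TorusSite 3 L => U ((Fin.cons (i : ZMod L) y : TorusSite 4 L), 0))).prod).det =
      ∏ f : Fin Nf,
        (1 + ((List.range L).map fun i : ℕ =>
            fermionSliceMatrix
                (fun e : Edge 3 L => U ((Fin.cons (i : ZMod L) e.1 : TorusSite 4 L), e.2.succ))
                (fun _ : Fin 1 => mq f) *
              sliceGaugeRot (Nf := 1)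
                (fun y : TorusSite 3 L =>
                  U ((Fin.cons (i : ZMod L) y : TorusSite 4 L), 0))).prod).det :=
  FlavourBlocks.det_flavour
    (FlavourBlocks.add_flavour FlavourBlocks.one_flavour
      (FlavourBlocks.list_prod_flavour
        (fun i : ℕ => FlavourBlocks.mul_flavour
          (FlavourBlocks.fermionSliceMatrix_flavour
            (fun e : Edge 3 L => U ((Fin.cons (i : ZMod L) e.1 : TorusSite 4 L), e.2.succ)) mq hm)
          (FlavourBlocks.sliceGaugeRot_flavour
            (fun y : TorusSite 3 L => U ((Fin.cons (i : ZMod L) y : TorusSite 4 L), 0))))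
        (List.range L)))

/-- **Flavour by flavour**: `det D^{AP}(U) = ∏_f det D_W^{AP}[U; m_f]`
(`det_diracMatrixAP_eq_prod_flavour`) with each one-flavour antiperiodic Wilson determinant in
Smit's honest-trace transfer form (antiperiodic capstone A,
`wilsonDiracAP_det_eq_smit_transfer_form`).
[cite: MontvayMunster1994, §4.1.3 (4.34), §5.1] [cite: Smit2023, §6.5 (6.87)–(6.91)] -/
theorem det_diracMatrixAP_eq_prod_flavour_transfer_form (Nf L : ℕ) [NeZero L]
    (U : GaugeConfig 4 L (Matrix.specialUnitaryGroup (Fin 3) ℂ)) (mq : Fin Nf → ℝ)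
    (hm : ∀ f, -1 < mq f) :
    (diracMatrixAP U mq).det =
      ∏ f : Fin Nf,
        ((∏ t : ZMod L,
            (sliceMassHop (fun e : Edge 3 L => U ((Fin.cons t e.1 : TorusSite 4 L), e.2.succ))
                (fun _ : Fin 1 => mq f)).det ^ 2) *
          (1 + ((List.range L).map fun i : ℕ =>
              fermionSliceMatrix
                  (fun e : Edge 3 L => U ((Fin.cons (i : ZMod L) e.1 : TorusSite 4 L), e.2.succ))
                  (fun _ : Fin 1 => mq f) *
                sliceGaugeRot (Nf := 1)
                  (fun y : TorusSite 3 L =>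
                    U ((Fin.cons (i : ZMod L) y : TorusSite 4 L), 0))).prod).det) := by
  rw [det_diracMatrixAP_eq_prod_flavour]
  exact Finset.prod_congr rfl fun f _ => wilsonDiracAP_det_eq_smit_transfer_form L U (mq f) (hm f)

/-- **The `N_f`-flavour antiperiodic capstone A.**  For an `SU(3)` gauge field `U` on the
four-torus `(ℤ/L)⁴` and `N_f` flavours of `r = 1` Wilson quarks of bare masses `m_f > −1`,
`det D^{AP}(U) = ∏_t det A(U_t)² · det (1 + ∏_{t=0}^{L−1} M_F(U_t) G_t)` with
`A(U_t) = sliceMassHop U_t mq`, `M_F(U_t) = fermionSliceMatrix U_t mq` and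
`G_t = sliceGaugeRot (y ↦ U((t, y), 0))`: flavour by flavour this is the antiperiodic capstone A,
and both factors factorise over flavours (`A(U_t)` and `1 + ∏_t M_F G_t` are
flavour-block-diagonal).
[cite: MontvayMunster1994, §4.1.3 (4.34), §5.1] [cite: Luscher1977, pp. 283–292]
[cite: Smit2023, §6.5 (6.87)–(6.91)] -/
theorem det_diracMatrixAP_eq_smit_transfer_form (Nf L : ℕ) [NeZero L]
    (U : GaugeConfig 4 L (Matrix.specialUnitaryGroup (Fin 3) ℂ)) (mq : Fin Nf → ℝ)
    (hm : ∀ f, -1 < mq f) :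
    (diracMatrixAP U mq).det =
      (∏ t : ZMod L,
          (sliceMassHop (fun e : Edge 3 L => U ((Fin.cons t e.1 : TorusSite 4 L), e.2.succ))
              mq).det ^ 2) *
        (1 + ((List.range L).map fun i : ℕ =>
            fermionSliceMatrix
                (fun e : Edge 3 L => U ((Fin.cons (i : ZMod L) e.1 : TorusSite 4 L), e.2.succ))
                mq *
              sliceGaugeRot (Nf := Nf)
                (fun y : TorusSite 3 L =>
                  U ((Fin.cons (i : ZMod L) y : TorusSite 4 L), 0))).prod).det := by
  rw [det_diracMatrixAP_eq_prod_flavour_transfer_form Nf L U mq hm, Finset.prod_mul_distrib,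
    det_one_add_transfer_prod_eq_prod_flavour Nf L U mq hm]
  congr 1
  rw [Finset.prod_comm]
  refine Finset.prod_congr rfl fun t _ => ?_
  rw [DiracMatrixTransferForm.det_sliceMassHop_eq_prod_flavour, Finset.prod_pow]

end DiracMatrixAPTrace

/-- **Stub `det_diracMatrixAP_eq_trace_fermionSliceOp` of line `Sketch` (the `N_f`-flavour
thermal trace formula).**  For an `SU(3)` gauge field `U` on the four-torus `(ℤ/L)⁴` and `N_f`
flavours of `r = 1` Wilson quarks of bare masses `m_f > −1` (fundamental representation) with
time-antiperiodic boundary condition, the determinant of the flavour-diagonal antiperiodic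
Wilson–Dirac matrix `D^{AP}(U) = diracMatrixAP U mq` is the honest Fock-space trace
`det D^{AP}(U) = Tr ∏_{t=0}^{L−1} T̂_F(U_t) Γ(G_t)` over the `N_f`-flavour slice Fock space,
with `U_t` the slice configuration `(x⃗, j) ↦ U((t, x⃗), j+1)`,
`T̂_F(U_t) = fermionSliceOp U_t mq` Smit's `N_f`-flavour fermionic transfer operator (6.91) and
`Γ(G_t) = fockGaugeAct (y ↦ U((t, y), 0))` the Fock-space gauge rotation by the temporal links
(Gauss law); antiperiodic time gives the honest thermal trace (Montvay–Münster (4.34)).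
[cite: MontvayMunster1994, §4.1.3 (4.34), §5.1] [cite: Luscher1977, pp. 283–292]
[cite: Smit2023, §6.5 (6.87)–(6.91)] -/
theorem det_diracMatrixAP_eq_trace_fermionSliceOp : ∀ (Nf L : ℕ) [NeZero L] (U : GaugeConfig 4 L (Matrix.specialUnitaryGroup (Fin 3) ℂ)) (mq : Fin Nf → ℝ), (∀ f, -1 < mq f) → (diracMatrixAP U mq).det = (((List.range L).map fun i : ℕ => fermionSliceOp (fun e : Edge 3 L => U ((Fin.cons (i : ZMod L) e.1 : TorusSite 4 L), e.2.succ)) mq * fockGaugeAct (Nf := Nf) (fun y : TorusSite 3 L => U ((Fin.cons (i : ZMod L) y : TorusSite 4 L), 0))).prod).trace := by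
  intro Nf L _ U mq hm
  -- `N_f`-flavour antiperiodic capstone A:
  -- `det D^{AP}(U) = (∏_t det A(U_t)²) · det (1 + ∏_t M_F(U_t) G_t)`, the `ZMod L`-product
  -- rewritten as the ordered product over `List.range L`
  rw [DiracMatrixAPTrace.det_diracMatrixAP_eq_smit_transfer_form Nf L U mq hm,
    SupertraceTransferForm.prod_univ_zmod_eq]
  -- `det (1 + Y) = Tr Γ(reindex Y)` and `Γ ∘ reindex` through the ordered product
  exact APTraceForm.trace_form (sliceQuarkEquiv (Nf := Nf) (S := L))
    (fun i : ℕ => (sliceMassHop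
      (fun e : Edge 3 L => U ((Fin.cons (i : ZMod L) e.1 : TorusSite 4 L), e.2.succ)) mq).det ^ 2)
    (fun i : ℕ => fermionSliceMatrix
      (fun e : Edge 3 L => U ((Fin.cons (i : ZMod L) e.1 : TorusSite 4 L), e.2.succ)) mq)
    (fun i : ℕ => sliceGaugeRot (Nf := Nf)
      (fun y : TorusSite 3 L => U ((Fin.cons (i : ZMod L) y : TorusSite 4 L), 0)))
    L

end Summit.QuantumFields.QCD.Cruxes.StableActionBridge.Sketch

end
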